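import Summits.Ventures.PercRepro.PuncturedLYMRecSum

/-!
# PercRepro — (SP) BY SUPERPOSITION, PART 15c: THE CLOSED-FORM SUMS OF THE RECURSIVE CERTIFICATES (p10, gen 32)

The recursions of PuncturedLYMRecSum SUM to `(n − j)·Σ_{a<j} λ_a sʸ_a = Σ_{a<j} P_a + j·λ_{j−1}` and
`(n − j + 1)·Σ_{a<j−1} μ_a s'_a = Σ_{a<j−1} P_a + 2·μ_{j−2}·s'_{j−2}` (`sum_lamRec_sQy`, `sum_muRec_sQ'`), while
`Σ_{a<j} P_a = j − j(j+1)/n` (`sum_cdfQ`: the mean `j(j+1)/n` of the hypergeometric distribution, `sum_mul_classCount`)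
and `P_{j−1} = 1 − τ` (`cdfQ_top`).  With the bounds `λ_{j−1} ≤ d(j−1)`, `μ_{j−2} ≤ g(j−2)` of PuncturedLYMRecCert:
* **`sum_lamRec_le`** — `Σ_{a<j} λ_a sʸ_a ≤ (j − j(j+1)/n + 1/(n − j − 1))/(n − j)`;
* **`sum_muRec_le`** — `Σ_{a<j−1} μ_a s'_a ≤ (j − 1 − j(j+1)/n + τ + 2/(n − j − 1))/(n − j + 1)`.
Nothing here asserts (SP) in general; the assembly (THEOREM G) is PuncturedLYMAllJ.
-/

namespace PercRepro.PuncturedLYM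

open Finset

variable {α : Type} [Fintype α]

/-! ### Summing the recursions -/

/-- `Σ_{a<k} P_a = (n − j)·Σ_{a<k} λ_a sʸ_a − (j + 1 − k)·λ_{k−1}·sʸ_{k−1}` for `1 ≤ k ≤ j` (`2j + 1 ≤ n`). -/
theorem sum_lamRec_sQy {j : ℕ} (hn : 2 * j + 1 ≤ Fintype.card α) :
    ∀ k, 1 ≤ k → k ≤ j →
      ∑ a ∈ range k, cdfQ α j a =
        ((Fintype.card α : ℚ) - j) * ∑ a ∈ range k, lamRec α j a * sQy α j a -
          ((j : ℚ) + 1 - k) * lamRec α j (k - 1) * sQy α j (k - 1) := by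
  intro k hk1 hkj
  induction k, hk1 using Nat.le_induction with
  | base =>
    simp only [sum_range_one, Nat.sub_self, Nat.cast_one]
    have := lamRec_step_zero (α := α) (j := j) (by omega) hn
    linarith
  | succ k hk ih =>
    have ih' := ih (by omega)
    rw [sum_range_succ, sum_range_succ, ih']
    have hs := lamRec_step (α := α) (j := j) (a := k) hk (by omega) hn
    simp only [Nat.add_sub_cancel]
    push_cast
    linarith [hs]

/-- `Σ_{a<k} P_a = (n − j + 1)·Σ_{a<k} μ_a s'_a − (j + 1 − k)·μ_{k−1}·s'_{k−1}` for `1 ≤ k ≤ j − 1` (`2j + 1 ≤ n`). -/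
theorem sum_muRec_sQ' {j : ℕ} (hn : 2 * j + 1 ≤ Fintype.card α) :
    ∀ k, 1 ≤ k → k + 1 ≤ j →
      ∑ a ∈ range k, cdfQ α j a =
        ((Fintype.card α : ℚ) - j + 1) * ∑ a ∈ range k, muRec α j a * sQ' α j a -
          ((j : ℚ) + 1 - k) * muRec α j (k - 1) * sQ' α j (k - 1) := by
  intro k hk1 hkj
  induction k, hk1 using Nat.le_induction with
  | base =>
    simp only [sum_range_one, Nat.sub_self, Nat.cast_one]
    have := muRec_step_zero (α := α) (j := j) (by omega) hn
    linarith
  | succ k hk ih =>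
    have ih' := ih (by omega)
    rw [sum_range_succ, sum_range_succ, ih']
    have hs := muRec_step (α := α) (j := j) (a := k) hk (by omega) hn
    simp only [Nat.add_sub_cancel]
    push_cast
    linarith [hs]

/-! ### The sum of the distribution function -/

/-- `Σ_{a<k} C_{≤a} = Σ_{i<k} (k − i)·c_i` (natural numbers). -/
theorem sum_cumCount_eq (n j k : ℕ) :
    ∑ a ∈ range k, cumCount n j a = ∑ i ∈ range k, (k - i) * classCount n j i := by
  induction k with
  | zero => simp
  | succ k ih =>
    rw [sum_range_succ, ih]
    unfold cumCount
    rw [sum_range_succ (fun i => classCount n j i) k, sum_range_succ (fun i => (k + 1 - i) * classCount n j i) k,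
      Nat.add_sub_cancel_left, one_mul, ← add_assoc, ← sum_add_distrib]
    congr 1
    apply sum_congr rfl
    intro i hi
    have : k + 1 - i = (k - i) + 1 := by have := mem_range.1 hi; omega
    rw [this, add_mul, one_mul]

/-- `Σ_{i ≤ j+1} i·c_i = j·C(n − 1, j)` for `1 ≤ j ≤ n − 1`: the mean of the hypergeometric distribution. -/
theorem sum_mul_classCount (n j : ℕ) (hj : 1 ≤ j) (hjn : j + 1 ≤ n) :
    ∑ i ∈ range (j + 2), i * classCount n j i = j * (n - 1).choose j := by
  rw [sum_range_succ' (fun i => i * classCount n j i) (j + 1)]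
  simp only [zero_mul, add_zero]
  have hterm : ∀ i ∈ range (j + 1), (i + 1) * classCount n j (i + 1) = j * ((j - 1).choose i * (n - j).choose (j - i)) := by
    intro i hi
    unfold classCount
    have h := Nat.add_one_mul_choose_eq (j - 1) i
    have e : j - 1 + 1 = j := by omega
    rw [e] at h
    have e2 : j + 1 - (i + 1) = j - i := by omega
    rw [e2]
    calc (i + 1) * (j.choose (i + 1) * (n - j).choose (j - i))
        = (j.choose (i + 1) * (i + 1)) * (n - j).choose (j - i) := by ring
      _ = (j * (j - 1).choose i) * (n - j).choose (j - i) := by rw [← h]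
      _ = j * ((j - 1).choose i * (n - j).choose (j - i)) := by ring
  rw [sum_congr rfl hterm, ← mul_sum]
  congr 1
  have hV := Nat.add_choose_eq (j - 1) (n - j) j
  rw [Nat.sum_antidiagonal_eq_sum_range_succ (fun a b => (j - 1).choose a * (n - j).choose b)] at hV
  have e : j - 1 + (n - j) = n - 1 := by omega
  rw [e] at hV
  exact hV.symm

/-- `Σ_{a<j} P_a = j − j(j+1)/n` for `1 ≤ j`, `2j + 1 ≤ n`. -/
theorem sum_cdfQ {j : ℕ} (hj : 1 ≤ j) (hn : 2 * j + 1 ≤ Fintype.card α) :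
    ∑ a ∈ range j, cdfQ α j a = (j : ℚ) - (j : ℚ) * (j + 1) / Fintype.card α := by
  obtain ⟨n, hn_def⟩ : ∃ n, Fintype.card α = n := ⟨_, rfl⟩
  have hn' : 2 * j + 1 ≤ n := hn_def ▸ hn
  unfold cdfQ
  rw [hn_def, ← sum_div]
  have hC : (0 : ℚ) < (n.choose (j + 1) : ℕ) := by exact_mod_cast Nat.choose_pos (by omega)
  have hn0 : (0 : ℚ) < n := by exact_mod_cast (by omega : 0 < n)
  rw [div_eq_iff hC.ne']
  -- `Σ_{a<j} C_{≤a} = j·C(n, j+1) − j·C(n−1, j)` and `n·C(n−1, j) = (j+1)·C(n, j+1)`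
  have h1 : ∑ a ∈ range j, (cumCount n j a : ℚ) = ∑ i ∈ range j, ((j - i : ℕ) : ℚ) * classCount n j i := by
    have := congrArg (Nat.cast (R := ℚ)) (sum_cumCount_eq n j j)
    push_cast at this
    exact this
  have h2 : ∑ i ∈ range j, ((j - i : ℕ) : ℚ) * classCount n j i =
      (j : ℚ) * ∑ i ∈ range j, (classCount n j i : ℚ) - ∑ i ∈ range j, (i : ℚ) * classCount n j i := by
    rw [mul_sum, ← sum_sub_distrib]
    apply sum_congr rfl
    intro i hi
    rw [Nat.cast_sub (by have := mem_range.1 hi; omega)]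
    ring
  have h3 : ∑ i ∈ range j, (classCount n j i : ℚ) = (n.choose (j + 1) : ℕ) - ((n : ℚ) - j) := by
    have := sum_classCount_lt (α := α) (j := j) (by rw [hn_def]; omega)
    rw [hn_def] at this
    exact this
  have h4 : ∑ i ∈ range j, (i : ℚ) * classCount n j i = (j : ℚ) * ((n - 1).choose j : ℕ) - (j : ℚ) * ((n : ℚ) - j) := by
    have hall := sum_mul_classCount n j hj (by omega)
    have hall' : ∑ i ∈ range (j + 2), (i : ℚ) * classCount n j i = (j : ℚ) * ((n - 1).choose j : ℕ) := by
      have := congrArg (Nat.cast (R := ℚ)) hall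
      push_cast at this
      exact this
    rw [sum_range_succ, sum_range_succ] at hall'
    have hcj : (classCount n j j : ℚ) = (n : ℚ) - j := by
      unfold classCount
      rw [Nat.choose_self, Nat.add_sub_cancel_left, Nat.choose_one_right]
      push_cast [Nat.cast_sub (by omega : j ≤ n)]
      ring
    have hcj1 : (classCount n j (j + 1) : ℚ) = 0 := by
      unfold classCount
      rw [Nat.choose_succ_self]
      simp
    rw [hcj, hcj1] at hall'
    linarith [hall']
  have h5 : (n : ℚ) * ((n - 1).choose j : ℕ) = ((j : ℚ) + 1) * (n.choose (j + 1) : ℕ) := by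
    have := Nat.add_one_mul_choose_eq (n - 1) j
    have e : n - 1 + 1 = n := by omega
    rw [e] at this
    have := congrArg (Nat.cast (R := ℚ)) this
    push_cast at this
    linarith
  rw [h1, h2, h3, h4]
  field_simp
  nlinarith [h5]

/-! ### The bounds on the two certificate sums -/

/-- `P_{j−1} = 1 − τ`. -/
theorem cdfQ_top {j : ℕ} (hj : 1 ≤ j) (hn : 2 * j + 1 ≤ Fintype.card α) : cdfQ α j (j - 1) = 1 - tauQ α j := by
  unfold cdfQ tauQ
  have hC : (0 : ℚ) < ((Fintype.card α).choose (j + 1) : ℕ) := by exact_mod_cast Nat.choose_pos (by omega)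
  have h := sum_classCount_lt (α := α) (j := j) (by omega)
  have hcum : (cumCount (Fintype.card α) j (j - 1) : ℚ) = ∑ i ∈ range j, (classCount (Fintype.card α) j i : ℚ) := by
    unfold cumCount
    rw [Nat.sub_add_cancel hj]
    push_cast
    rfl
  rw [hcum, h]
  field_simp

/-- `P_a ≤ 1`. -/
theorem cdfQ_le_one {j a : ℕ} (ha : a ≤ j) (hn : 2 * j + 1 ≤ Fintype.card α) : cdfQ α j a ≤ 1 := by
  unfold cdfQ
  have hC : (0 : ℚ) < ((Fintype.card α).choose (j + 1) : ℕ) := by exact_mod_cast Nat.choose_pos (by omega)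
  rw [div_le_one hC]
  have : cumCount (Fintype.card α) j a ≤ cumCount (Fintype.card α) j (j + 1) := by
    unfold cumCount
    apply sum_le_sum_of_subset_of_nonneg (range_subset_range.2 (by omega))
    intro i _ _
    exact Nat.zero_le _
  rw [sum_classCount (by omega)] at this
  exact_mod_cast this

/-- **The profile certificate sum**: `Σ_{a<j} λ_a sʸ_a ≤ (j − j(j+1)/n + 1/(n − j − 1))/(n − j)` (`1 ≤ j`, `2j + 1 ≤ n`). -/
theorem sum_lamRec_le {j : ℕ} (hj : 1 ≤ j) (hn : 2 * j + 1 ≤ Fintype.card α) :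
    ∑ a ∈ range j, lamRec α j a * sQy α j a ≤
      ((j : ℚ) - (j : ℚ) * (j + 1) / Fintype.card α + 1 / ((Fintype.card α : ℚ) - j - 1)) /
        ((Fintype.card α : ℚ) - j) := by
  have hN : (0 : ℚ) < (Fintype.card α : ℚ) - j := by
    have : (j : ℚ) + 1 ≤ Fintype.card α := by exact_mod_cast (by omega : j + 1 ≤ Fintype.card α)
    linarith
  have hN1 : (0 : ℚ) < (Fintype.card α : ℚ) - j - 1 := by
    have : (j : ℚ) + 2 ≤ Fintype.card α := by exact_mod_cast (by omega : j + 2 ≤ Fintype.card α)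
    linarith
  have hsum := sum_lamRec_sQy (α := α) (j := j) hn j hj le_rfl
  rw [sum_cdfQ hj hn] at hsum
  -- `sʸ_{j−1} = j`, `λ_{j−1} ≤ d(j−1)`, `j·(n − j − 1)·d(j−1) = 1 − τ ≤ 1`
  have hsy : sQy α j (j - 1) = j := by
    unfold sQy
    have e1 : j - 1 - (j - 1) = 0 := Nat.sub_self _
    rw [e1, Nat.choose_zero_right, mul_one, Nat.choose_symm (by omega : 1 ≤ j), Nat.choose_one_right]
  have hlam := (lamRec_nonneg_le (α := α) (j := j) hn (j - 1) (by omega)).2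
  have htop := dFlux_top (α := α) (j := j) (by omega) (by omega)
  have hτ : 0 ≤ tauQ α j := tauQ_nonneg (by omega)
  -- `j·λ_{j−1} ≤ j·d(j−1) = (1 − τ)/(n − j − 1) ≤ 1/(n − j − 1)`
  have hjd : (j : ℚ) * dFlux α j (j - 1) ≤ 1 / ((Fintype.card α : ℚ) - j - 1) := by
    rw [le_div_iff₀ hN1]
    nlinarith [htop, hτ]
  have hjl : ((j : ℚ) + 1 - j) * lamRec α j (j - 1) * sQy α j (j - 1) ≤ 1 / ((Fintype.card α : ℚ) - j - 1) := by
    rw [hsy]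
    have : ((j : ℚ) + 1 - j) * lamRec α j (j - 1) * j = (j : ℚ) * lamRec α j (j - 1) := by ring
    rw [this]
    calc (j : ℚ) * lamRec α j (j - 1) ≤ (j : ℚ) * dFlux α j (j - 1) := mul_le_mul_of_nonneg_left hlam (by positivity)
      _ ≤ 1 / ((Fintype.card α : ℚ) - j - 1) := hjd
  rw [le_div_iff₀ hN]
  linarith [hsum, hjl]

/-- **The through-point certificate sum**:
`Σ_{a<j−1} μ_a s'_a ≤ (j − 1 − j(j+1)/n + τ + 2/(n − j − 1))/(n − j + 1)` (`2 ≤ j`, `2j + 1 ≤ n`). -/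
theorem sum_muRec_le {j : ℕ} (hj : 2 ≤ j) (hn : 2 * j + 1 ≤ Fintype.card α) :
    ∑ a ∈ range (j - 1), muRec α j a * sQ' α j a ≤
      ((j : ℚ) - 1 - (j : ℚ) * (j + 1) / Fintype.card α + tauQ α j + 2 / ((Fintype.card α : ℚ) - j - 1)) /
        ((Fintype.card α : ℚ) - j + 1) := by
  have hN : (0 : ℚ) < (Fintype.card α : ℚ) - j + 1 := by
    have : (j : ℚ) + 1 ≤ Fintype.card α := by exact_mod_cast (by omega : j + 1 ≤ Fintype.card α)
    linarith
  have hN1 : (0 : ℚ) < (Fintype.card α : ℚ) - j - 1 := by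
    have : (j : ℚ) + 2 ≤ Fintype.card α := by exact_mod_cast (by omega : j + 2 ≤ Fintype.card α)
    linarith
  have hsum := sum_muRec_sQ' (α := α) (j := j) hn (j - 1) (by omega) (by omega)
  -- `Σ_{a<j−1} P_a = Σ_{a<j} P_a − P_{j−1}`
  have hP : ∑ a ∈ range (j - 1), cdfQ α j a = (j : ℚ) - (j : ℚ) * (j + 1) / Fintype.card α - (1 - tauQ α j) := by
    have := sum_cdfQ (α := α) (j := j) (by omega) hn
    rw [← Nat.sub_add_cancel (by omega : 1 ≤ j), sum_range_succ, Nat.sub_add_cancel (by omega : 1 ≤ j),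
      cdfQ_top (by omega) hn] at this
    linarith
  rw [hP] at hsum
  -- `s'_{j−2} = C(j, 2)`, `μ_{j−2} ≤ g(j−2)`, `(n − j − 1)·g(j−2)·s'_{j−2} = P_{j−2} ≤ 1`
  have hmu := (muRec_nonneg_le (α := α) (j := j) hn (j - 2) (by omega)).2
  have hg := gDef_mul_sQ' (α := α) (j := j) (a := j - 2) (by omega) hn
  have hP2 := cdfQ_le_one (α := α) (j := j) (a := j - 2) (by omega) hn
  unfold cdfQ at hP2
  have e1 : ((j : ℚ) - 1 - ((j - 2 : ℕ) : ℚ)) = 1 := by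
    rw [Nat.cast_sub (by omega : 2 ≤ j)]
    push_cast
    ring
  have e2 : ((Fintype.card α : ℚ) - 2 * j + ((j - 2 : ℕ) : ℚ) + 1) = (Fintype.card α : ℚ) - j - 1 := by
    rw [Nat.cast_sub (by omega : 2 ≤ j)]
    push_cast
    ring
  rw [e1, e2] at hg
  rw [e1] at hmu
  have hs0 : 0 ≤ sQ' α j (j - 2) := by unfold sQ'; positivity
  have hmus : muRec α j (j - 2) * sQ' α j (j - 2) ≤ 1 / ((Fintype.card α : ℚ) - j - 1) := by
    rw [le_div_iff₀ hN1]
    calc muRec α j (j - 2) * sQ' α j (j - 2) * ((Fintype.card α : ℚ) - j - 1)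
        ≤ gDef α j (j - 2) * sQ' α j (j - 2) * ((Fintype.card α : ℚ) - j - 1) := by
          apply mul_le_mul_of_nonneg_right _ hN1.le
          exact mul_le_mul_of_nonneg_right (by linarith [hmu]) hs0
      _ = ((Fintype.card α : ℚ) - j - 1) * gDef α j (j - 2) * sQ' α j (j - 2) := by ring
      _ = 1 * ((cumCount (Fintype.card α) j (j - 2) : ℚ) / ((Fintype.card α).choose (j + 1) : ℕ)) := hg
      _ ≤ 1 := by rw [one_mul]; exact hP2
  have ek : ((j : ℚ) + 1 - ((j - 1 : ℕ) : ℚ)) = 2 := by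
    rw [Nat.cast_sub (by omega : 1 ≤ j)]
    push_cast
    ring
  have ek2 : j - 1 - 1 = j - 2 := by omega
  rw [ek, ek2] at hsum
  rw [le_div_iff₀ hN]
  have : 2 * (muRec α j (j - 2) * sQ' α j (j - 2)) ≤ 2 / ((Fintype.card α : ℚ) - j - 1) := by
    have := mul_le_mul_of_nonneg_left hmus (by norm_num : (0 : ℚ) ≤ 2)
    rw [mul_one_div] at this
    exact this
  nlinarith [hsum, this]

end PercRepro.PuncturedLYM
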